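import Summits.Ventures.HSemireg.WedgeHankelRecurrenceGaussGegenbauerDifferentialEquation

/-!
# Venture HSemireg — **STIELTJES-TYPE BOUNDS FOR THE EXTREME ZEROS FROM THE EQUILIBRIUM IDENTITIES**: at the largest zero every term of `Σ_{j ≠ t} 1∕(x_t − x_j)` is `≥ 1∕(x_t − x_0) > 0`, so the
# sum is `≥ t∕(x_t − x_0)`; fed into N388 ∕ N389 ∕ N392 this gives: HERMITE `x_t ≥ √t`; LAGUERRE `x_0 < α + 1` and `x_t > 2t + α + 1`; LEGENDRE `x_t² ≥ t∕(t+2)` (equality for `P_2`) — for the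
# zeros `x_0 < ⋯ < x_t` of `He_{t+1}`, `L^{(α)}_{t+1}`, `P_{t+1}` (`t ≥ 1`)

HONEST FRAMING. Part of the Lean index of the computation cell `pub-hsemireg` (seat p10 gen 46, Sunday typer «UNIFORM-IN-n»).  Finite sums and `Real.sqrt` only; no variety, no cohomology theory, no sheaf,
no Ext group and no semiregularity map is constructed here; nothing here says that HC / HC_CM / HC_AV holds; no Literature fact (unproved `Prop`) is declared or used.  Custodian versions as in
`WedgeHankelSiegelIdeal` (1/3).
SOURCES (cited).  G. Szegő, *Orthogonal Polynomials*, §6.7 (Stieltjes' problem) and §6.2 ∕ §6.31 (elementary bounds for the extreme zeros of the classical polynomials, e.g. (6.31.12) for Laguerre,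
(6.2.x)); T. J. Stieltjes, C. R. Acad. Sci. 100 (1885) 439–440, 620–622; M. E. H. Ismail, *Classical and Quantum Orthogonal Polynomials* (2005), §3.5.
PROOF TYPED HERE.  `sum_inv_sub_last_ge`: `t` terms each `≥ 1∕(x_t − x_0)`; then the identities `Σ = x_t∕2` (N388), `= (x_k − α − 1)∕(2x_k)` (N389), `= x_t∕(1 − x_t²)` (N392) and the symmetry `x_0 = −x_t`
(N359, N390) are rearranged.
DEDUP DISCLOSURE (`rg -n -i 'largest_zero_g|smallest_zero_lt|electrostatic_bound' Summits/Ventures/HSemireg`, 2026-09-03): N359 (`|x_k| ≤ √t + √(t+1)` for Hermite, Gershgorin), N376 (Laguerre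
`< 2t+1+α+2√(t(t+α))`), N379 (uniform `cos` bounds) are UPPER bounds; the LOWER bounds for the largest zero and the Laguerre `x_0 < α + 1` are new.  The 5 names below: 0 hits tree-wide.

WHAT IS IN THE TREE.  N388 `hermite_zeros_electrostatic`; N389 `laguerre_zeros_electrostatic`; N392 `legendre_zeros_electrostatic`; N359 `hermite_zeros` (symmetry); N390 `gegenbauer_zeros`.
THIS FILE (namespace `Summit.Ventures.HSemireg.Wedge.HankelOuter` continued; CHAINED on N392 (import only); 0 definitions):
* §1158 `sum_inv_sub_last_ge` (`Σ_{j ≠ t} 1∕(x_t − x_j) ≥ t∕(x_t − x_0)`, and `> 0`), `sum_inv_sub_first_neg` (`Σ_{j ≠ 0} 1∕(x_0 − x_j) < 0`), **`hermite_largest_zero_ge_sqrt`**,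
  **`laguerre_extreme_zeros_bounds`** (`x_0 < α + 1`, `2t + α + 1 < x_t`), **`legendre_largest_zero_sq_ge`** (`t∕(t+2) ≤ x_t²`).
CAVEATS.  Crude (first-order) consequences of the equilibrium; sharper classical bounds (Szegő §6.31–6.32) are not attempted.  Nothing Ext-side.  New names only.
-/

open Module Polynomial
open scoped Matrix Polynomial

namespace Summit.Ventures.HSemireg.Wedge.HankelOuter

/-! ## §1158. Bounds for the extreme zeros from the equilibrium identities -/

/-- **At the largest node: `Σ_{j ≠ t} 1∕(x_t − x_j) ≥ t∕(x_t − x_0)` and the sum is positive (`t ≥ 1`).** [this file, §1158] -/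
theorem sum_inv_sub_last_ge {t : ℕ} (ht : 1 ≤ t) {x : Fin (t + 1) → ℝ} (hx : StrictMono x) :
    (t : ℝ) / (x (Fin.last t) - x 0) ≤ ∑ j ∈ Finset.univ.erase (Fin.last t), (x (Fin.last t) - x j)⁻¹ ∧ 0 < ∑ j ∈ Finset.univ.erase (Fin.last t), (x (Fin.last t) - x j)⁻¹ := by
  have hgap : 0 < x (Fin.last t) - x 0 := sub_pos.2 (hx (Fin.lt_def.2 (by simp; omega)))
  have hterm : ∀ j ∈ Finset.univ.erase (Fin.last t), (x (Fin.last t) - x 0)⁻¹ ≤ (x (Fin.last t) - x j)⁻¹ := fun j hj => by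
    have hjl : j < Fin.last t := lt_of_le_of_ne (Fin.le_last j) (Finset.mem_erase.1 hj).1
    have h1 : 0 < x (Fin.last t) - x j := sub_pos.2 (hx hjl)
    exact inv_anti₀ h1 (by linarith [hx.monotone (Fin.zero_le j)])
  have hcard : (Finset.univ.erase (Fin.last t)).card = t := by rw [Finset.card_erase_of_mem (Finset.mem_univ _), Finset.card_univ, Fintype.card_fin, Nat.add_sub_cancel]
  have hsum := Finset.sum_le_sum hterm
  rw [Finset.sum_const, hcard, nsmul_eq_mul] at hsum
  refine ⟨by rw [div_eq_mul_inv]; exact hsum, lt_of_lt_of_le ?_ hsum⟩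
  have : (0 : ℝ) < t := by exact_mod_cast ht
  positivity

/-- **At the smallest node the sum is negative: `Σ_{j ≠ 0} 1∕(x_0 − x_j) < 0`** (`t ≥ 1`). [this file, §1158] -/
theorem sum_inv_sub_first_neg {t : ℕ} (ht : 1 ≤ t) {x : Fin (t + 1) → ℝ} (hx : StrictMono x) : ∑ j ∈ Finset.univ.erase (0 : Fin (t + 1)), (x 0 - x j)⁻¹ < 0 := by
  have hneg : ∀ j ∈ Finset.univ.erase (0 : Fin (t + 1)), (x 0 - x j)⁻¹ < 0 := fun j hj =>
    inv_lt_zero.2 (sub_neg.2 (hx (lt_of_le_of_ne (Fin.zero_le j) (Ne.symm (Finset.mem_erase.1 hj).1))))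
  have hne : (Finset.univ.erase (0 : Fin (t + 1))).Nonempty := ⟨Fin.last t, Finset.mem_erase.2 ⟨fun h => by have := congrArg Fin.val h; simp at this; omega, Finset.mem_univ _⟩⟩
  exact Finset.sum_neg hneg hne

/-- **HERMITE: the largest zero of `He_{t+1}` satisfies `x_t ≥ √t`** (`t ≥ 1`; from `x_t∕2 = Σ_{j≠t} 1∕(x_t − x_j) ≥ t∕(x_t − x_0) = t∕(2x_t)`). [Szegő §6.7 ∕ §6.31 (cf.); this file, §1158] -/
theorem hermite_largest_zero_ge_sqrt {t : ℕ} (ht : 1 ≤ t) {x : Fin (t + 1) → ℝ} (hx : StrictMono x)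
    (hxq : (Polynomial.hermite (t + 1)).map (Int.castRingHom ℝ) = ∏ k, (Polynomial.X - C (x k))) (hsymm : ∀ k, x k = -x (Fin.rev k)) :
    Real.sqrt t ≤ x (Fin.last t) := by
  have hel := hermite_zeros_electrostatic hx hxq (Fin.last t)
  obtain ⟨hge, hpos⟩ := sum_inv_sub_last_ge ht hx
  rw [hel] at hge hpos
  have h0 : x 0 = -x (Fin.last t) := by rw [hsymm 0, Fin.rev_zero]
  rw [h0, sub_neg_eq_add, ← two_mul] at hge
  have hxt : 0 < x (Fin.last t) := by linarith
  have h2 : (t : ℝ) ≤ x (Fin.last t) ^ 2 := by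
    rw [div_le_iff₀ (by positivity)] at hge
    nlinarith
  calc Real.sqrt t ≤ Real.sqrt (x (Fin.last t) ^ 2) := Real.sqrt_le_sqrt h2
    _ = x (Fin.last t) := Real.sqrt_sq hxt.le

/-- **LAGUERRE: `x_0 < α + 1` and `x_t > 2t + α + 1`** for the zeros of `L^{(α)}_{t+1}` (`α > −1`, `t ≥ 1`). [Szegő (6.31.12) (cf.); this file, §1158] -/
theorem laguerre_extreme_zeros_bounds {L : ℕ → ℝ[X]} {a b : ℕ → ℝ} {α : ℝ} (hL0 : L 0 = 1) (hL1 : L 1 = Polynomial.X - C (a 0))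
    (hLrec : ∀ n, L (n + 2) = (Polynomial.X - C (a (n + 1))) * L (n + 1) - C (b (n + 1)) * L n) (ha : ∀ n, a n = 2 * n + 1 + α)
    (hb : ∀ n, b (n + 1) = ((n : ℝ) + 1) * ((n : ℝ) + 1 + α)) {t : ℕ} (ht : 1 ≤ t) {x : Fin (t + 1) → ℝ} (hx : StrictMono x)
    (hxq : L (t + 1) = ∏ k, (Polynomial.X - C (x k))) (hpos : ∀ k, 0 < x k) : x 0 < α + 1 ∧ 2 * t + α + 1 < x (Fin.last t) := by
  constructor
  · have hel := laguerre_zeros_electrostatic hL0 hL1 hLrec ha hb hx hxq hpos 0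
    have hneg := sum_inv_sub_first_neg ht hx
    rw [hel, div_lt_iff₀ (by linarith [hpos 0]), zero_mul] at hneg
    linarith
  · have hel := laguerre_zeros_electrostatic hL0 hL1 hLrec ha hb hx hxq hpos (Fin.last t)
    obtain ⟨hge, -⟩ := sum_inv_sub_last_ge ht hx
    rw [hel] at hge
    have hxt := hpos (Fin.last t)
    have hx0 := hpos 0
    have hgap : 0 < x (Fin.last t) - x 0 := sub_pos.2 (hx (Fin.lt_def.2 (by simp; omega)))
    -- `t/(x_t − x_0) ≤ (x_t − α − 1)/(2 x_t)` and `t/x_t < t/(x_t − x_0)`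
    have h1 : (t : ℝ) / x (Fin.last t) < (t : ℝ) / (x (Fin.last t) - x 0) :=
      div_lt_div_of_pos_left (by exact_mod_cast ht) hgap (by linarith)
    have h2 := h1.trans_le hge
    rw [div_lt_iff₀ hxt] at h2
    have h3 : (x (Fin.last t) - α - 1) / (2 * x (Fin.last t)) * x (Fin.last t) = (x (Fin.last t) - α - 1) / 2 := by
      field_simp
    rw [h3] at h2
    linarith

/-- **LEGENDRE: the largest zero of `P_{t+1}` satisfies `x_t² ≥ t∕(t+2)`** (`t ≥ 1`; equality for `t = 1`: `x = 1∕√3`). [Szegő §6.21 (cf.); this file, §1158] -/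
theorem legendre_largest_zero_sq_ge {q : ℕ → ℝ[X]} {a b : ℕ → ℝ} (hq0 : q 0 = 1) (hq1 : q 1 = Polynomial.X - C (a 0))
    (hrec : ∀ n, q (n + 2) = (Polynomial.X - C (a (n + 1))) * q (n + 1) - C (b (n + 1)) * q n) (ha : ∀ n, a n = 0)
    (hb : ∀ n, b (n + 1) = ((n : ℝ) + 1) ^ 2 / (4 * ((n : ℝ) + 1) ^ 2 - 1)) {t : ℕ} (ht : 1 ≤ t) {x : Fin (t + 1) → ℝ} (hx : StrictMono x)
    (hxq : q (t + 1) = ∏ k, (Polynomial.X - C (x k))) (hmem : ∀ k, -1 < x k ∧ x k < 1) (hsymm : ∀ k, x k = -x (Fin.rev k)) :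
    (t : ℝ) / ((t : ℝ) + 2) ≤ x (Fin.last t) ^ 2 := by
  have hel := legendre_zeros_electrostatic hq0 hq1 hrec ha hb hx hxq hmem (Fin.last t)
  obtain ⟨hge, hpos⟩ := sum_inv_sub_last_ge ht hx
  rw [hel] at hge hpos
  have h0 : x 0 = -x (Fin.last t) := by rw [hsymm 0, Fin.rev_zero]
  rw [h0, sub_neg_eq_add, ← two_mul] at hge
  have h1 : 0 < 1 - x (Fin.last t) ^ 2 := by nlinarith [(hmem (Fin.last t)).1, (hmem (Fin.last t)).2]
  have hxt : 0 < x (Fin.last t) := by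
    have := div_pos_iff.1 hpos
    rcases this with ⟨h, -⟩ | ⟨-, h⟩
    · exact h
    · linarith
  have h2 := (div_le_iff₀ (by positivity : (0 : ℝ) < 2 * x (Fin.last t))).1 hge
  rw [div_mul_eq_mul_div, le_div_iff₀ h1] at h2
  rw [div_le_iff₀ (by positivity)]
  nlinarith

end Summit.Ventures.HSemireg.Wedge.HankelOuter
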